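import Summits.HodgeConjecture.HodgeCM.PerL34.GenuineCoeffInput_1

/-! PORT of `HodgeCM/PerL34/GenuineCoeffInput.lean` (HodgeCMPerL run 82) — part 2: continuation of `Summits.HodgeConjecture.HodgeCM.PerL34.GenuineCoeffInput_1` (split at a top-level declaration boundary by port_pkg.py; scope re-opened below; declarations unchanged). -/

-- port_pkg: scope re-opened for this part (file-level context, then the namespace/section stack open at the cut)
set_option linter.unusedSectionVars false
noncomputable section
open MeasureTheory MeasureTheory.Measure Set Metric Function Complex ComplexConjugate Topology Filter
open scoped RestrictedProduct InnerProductSpace NNReal ENNReal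
namespace HodgeCM.PerL34.PureTensor
open HodgeCM.PerL34.SplitShells HodgeCM.PerL34.AdelicFactorisation HodgeCM.PerL34.RestrictedMeasure
open HodgeCM.PerL34.NoSmallSubgroups HodgeCM.PerL34.EulerFactorisation HodgeCM.PerL34.DiscreteFD
open HodgeCM.PerL34.LocalFactors HodgeCM.PerL34.LocalFactors.DilationModel
open HodgeCM.PerL34.LocalModulus HodgeCM.PerL34.SplitPlaceDilation
open HodgeCM.PerL34.RallisIP HodgeCM.PerL34.Doubling HodgeCM.PerL34.N31d NumberField IsDedekindDomain
open HodgeCM.PerL34.IdelePlaces HodgeCM.PerL34.RestrictedRegroup HodgeCM.PerL34.RestrictedCutout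
open HodgeCM.PerL34.IdelicTorusModel HodgeCM.PerL34.IdelicTorusModel.Genuine
attribute [local instance] LocalFactors.DilationModel.Adic.nontriviallyNormedField
  LocalFactors.DilationModel.Adic.properSpace
section ofCoeffInput
variable (L : Type) [Field L] [NumberField L] [IsCMField L]
variable [DecidableEq (Place (maximalRealSubfield L))]
  [∀ v : HeightOneSpectrum (𝓞 (maximalRealSubfield L)), MeasurableSpace (v.adicCompletion (maximalRealSubfield L))]
  [∀ v : HeightOneSpectrum (𝓞 (maximalRealSubfield L)), BorelSpace (v.adicCompletion (maximalRealSubfield L))]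
  (S₀ : Finset (Place (maximalRealSubfield L)))
  {Sp : Type} [NormedAddCommGroup Sp] [InnerProductSpace ℂ Sp]
  {W : Type} [AddCommGroup W] [Module L W]
  {H Sbox : Type} [Group H] [AddCommGroup Sbox] [Module ℂ Sbox]
  {h : W →ₗ⋆[L] W →ₗ[L] L} (hW : IsLine L W) (hh : Anisotropic h)
  (D : DoublingDatum (Model L) H Sp Sbox) (GU : ThetaSide Sp Sbox)
  (j : isomBox h →* H) (hj : ∀ d : unitary L, j ⟨iotaSnd d, iotaSnd_mem h d⟩ = D.ι (1, unitaryToModel L d))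
  (χ : Model L →* Circle) (hχΓ : ∀ d : unitary L, χ (unitaryToModel L d) = 1)
  (hχVΓ : ∀ d : unitary L, D.χV (unitaryToModel L d) = 1)
  {hP : ∀ Ψ : Sbox, ∀ p ∈ (stabDelta L W).subgroupOf (isomBox h), ∀ x : H,
    D.fSW Ψ (j p * x) = D.fSW Ψ x}
  (P : GluePrintInputs D GU h j hP)
  (hloc : ∀ (i : Place (maximalRealSubfield L)) (v : Sp),
    Continuous fun g : locTorus (maximalRealSubfield L) L i => D.ω (RestrictedProduct.mulSingle (genLevel L) i g) v)
  {T' : Finset (Place (maximalRealSubfield L))} (hχT' : RestrictedProduct.boxSubgroup (genLevel L) T' ≤ χ.ker)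
  (hlocχ : ∀ i ∈ T', Continuous fun g : locTorus (maximalRealSubfield L) L i => χ (RestrictedProduct.mulSingle (genLevel L) i g))
section direct
variable (φ : Sp) (hφ : ‖φ‖ = 1)
  {T : Finset (Place (maximalRealSubfield L))} (hK : ∀ k ∈ RestrictedProduct.boxSubgroup (genLevel L) T, D.ω k φ = φ)
  (hM : ∀ S : Finset (Place (maximalRealSubfield L)), T ⊆ S → ∀ y : (i : ↥S) → locTorus (maximalRealSubfield L) L i,
    inner ℂ φ (D.ω (extendOne (genLevel L) S y) φ) = ∏ i : ↥S, localCoeff (genLevel L) D.ω φ i (y i))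
  {S : Finset (Place (maximalRealSubfield L))} (hTS : T ⊆ S) (hT'S : T' ⊆ S)
  (hS : ∀ v : InfinitePlace (maximalRealSubfield L), Sum.inl v ∈ S)
  (X : GenuineCoeffInput L S Sp D.ω φ χ)
include hW hh hj hχΓ hχVΓ P hφ hloc hK hM hTS hT'S hS X
set_option synthInstance.maxHeartbeats 200000 in
-- (as in pv09-g5 #1–#4: the `SMul Γ (Model L)` instance behind `IsFundamentalDomain` is slow to find at these types)
/-- **S3 END from the COEFFICIENT-LEVEL input.**  pv09-g4's `exists_compactDomain_thetaLift_ne_zero_of_model` fed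
exactly as in pv09-g5's `exists_compactDomain_thetaLift_ne_zero_genuine_base` (`L₀ := L⁺`, `w := basePlaceOf`,
`τ := baseTriv`, `ord / ϖ / ϖF` derived from the chart), except that the two dictionary binders `coeff_eq` / `coeffS`
and the constants `cS_v > 0` are READ OFF `X : GenuineCoeffInput` instead of being derived from intertwiners. -/
theorem exists_compactDomain_thetaLift_ne_zero_genuine_of_coeffInput [IsFiniteMeasure GU.μ] :
    ∃ 𝓕 : Set (Model L), IsCompact 𝓕 ∧ (interior 𝓕).Nonempty ∧ MeasurableSet 𝓕 ∧
      IsFundamentalDomain (unitaryToModel L).range 𝓕 (haarDatum (genLevel L) (isCompact_genLevel L) (isOpen_genLevel L) S₀).μ ∧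
      (haarDatum (genLevel L) (isCompact_genLevel L) (isOpen_genLevel L) S₀).μ 𝓕 ≠ 0 ∧
      (haarDatum (genLevel L) (isCompact_genLevel L) (isOpen_genLevel L) S₀).μ 𝓕 ≠ ⊤ ∧
      ∀ [IsFiniteMeasure (((haarDatum (genLevel L) (isCompact_genLevel L) (isOpen_genLevel L) S₀).μ).restrict 𝓕)]
        (hk : Measurable (Function.uncurry (thetaFn D GU φ))) {Ck : ℝ} (hCk : 0 ≤ Ck)
        (hkC : ∀ q u, ‖thetaFn D GU φ q u‖ ≤ Ck),
        PeterssonFubini.theta GU.μ (((haarDatum (genLevel L) (isCompact_genLevel L) (isOpen_genLevel L) S₀).μ).restrict 𝓕) hk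
          (measurable_coe_char (genLevel L) (isOpen_genLevel L) χ hχT' hlocχ) hCk hkC (norm_coe_char_le χ) ≠ 0 := by
  -- the identification as a bare group isomorphism, and its level property `τ(B_v) = 𝒪_vˣ`
  let τU : ∀ i, i ∉ S → IsSplitPlace L i →
      (locTorus (maximalRealSubfield L) L i ≃* ((basePlaceOf L i).adicCompletion (maximalRealSubfield L))ˣ) :=
    fun i _ hs => (baseTriv L i hs).toMulEquiv
  have hτUB : ∀ i (hi : i ∉ S) (hs : IsSplitPlace L i), ∀ g : locTorus (maximalRealSubfield L) L i,
      g ∈ genLevel L i ↔ ‖((τU i hi hs g : ((basePlaceOf L i).adicCompletion (maximalRealSubfield L))ˣ) :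
        (basePlaceOf L i).adicCompletion (maximalRealSubfield L))‖ = 1 :=
    fun i _ hs g => mem_genLevel_iff_norm_baseTriv_eq_one L i hs g
  exact exists_compactDomain_thetaLift_ne_zero_of_model (genLevel L) (isCompact_genLevel L) (isOpen_genLevel L) S₀
    hW hh D GU (maximalRealSubfield L) L (unitaryToModel L) (unitaryToModel_injective L)
    (torusEquiv (maximalRealSubfield L) L).symm (torusEquiv_symm_unitaryToModel_mem L)
    (fun _ ha => torusEquiv_mem_range_unitaryToModel L ha) j hj χ hχΓ hχVΓ P φ hφ hloc hχT' hlocχ hK hM hTS hT'S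
    (maximalRealSubfield L) (basePlaceOf L) (basePlaceOf_injOn L hS) X.ν
    (fun i _ hs => coe_genLevel_eq_univ L i hs)
    (ordOfIdent S (IsSplitPlace L) (maximalRealSubfield L) (basePlaceOf L) (fun i => baseUnifF L (basePlaceOf L i))
      (fun i _ => isUniformizer_baseUnifF L (basePlaceOf L i)) τU)
    (unifOfIdent S (IsSplitPlace L) (maximalRealSubfield L) (basePlaceOf L) (fun i => baseUnifF L (basePlaceOf L i)) τU)
    (fun i => baseUnifF L (basePlaceOf L i)) (fun i _ => isUniformizer_baseUnifF L (basePlaceOf L i))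
    (ordOfIdent_unif S (IsSplitPlace L) (maximalRealSubfield L) (basePlaceOf L) (fun i => baseUnifF L (basePlaceOf L i))
      (fun i _ => isUniformizer_baseUnifF L (basePlaceOf L i)) τU)
    (ordOfIdent_eq_one_iff (genLevel L) S (IsSplitPlace L) (maximalRealSubfield L) (basePlaceOf L) (fun i => baseUnifF L (basePlaceOf L i))
      (fun i _ => isUniformizer_baseUnifF L (basePlaceOf L i)) τU hτUB)
    X.hν
    (fun i hi hs n => Transfer.coeff_zpow_of_coeff_eq (genLevel L) D.ω φ
      (Adic.muV (maximalRealSubfield L) (basePlaceOf L i)) (X.ν i) i (τU i hi hs).toMonoidHom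
      (unifOfIdent S (IsSplitPlace L) (maximalRealSubfield L) (basePlaceOf L) (fun i => baseUnifF L (basePlaceOf L i)) τU i)
      (baseUnifF L (basePlaceOf L i))
      (τU_unifOfIdent S (IsSplitPlace L) (maximalRealSubfield L) (basePlaceOf L) (fun i => baseUnifF L (basePlaceOf L i)) τU i hi hs)
      _ (X.hcoeffU i hi hs) n)
    (fun i _ hs => baseTriv L i hs) X.x₀ X.r X.c X.hr X.hr0 X.hc X.hνS X.hχS X.hcoeffS
    (fun i _ hs => compactSpace_of_not_isSplitPlace L i hs) X.hiso

end direct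

section embedding

variable
  -- the TORUS MODEL `(Sp₁, ω₁, φ₁)` with its torus side discharged at coefficient level
  {Sp₁ : Type} [NormedAddCommGroup Sp₁] [InnerProductSpace ℂ Sp₁]
  (ω₁ : Model L →* (Sp₁ ≃ₗᵢ[ℂ] Sp₁)) (φ₁ : Sp₁) (hφ₁ : ‖φ₁‖ = 1)
  {T : Finset (Place (maximalRealSubfield L))} (hK₁ : ∀ k ∈ RestrictedProduct.boxSubgroup (genLevel L) T, ω₁ k φ₁ = φ₁)
  (hM₁ : ∀ S : Finset (Place (maximalRealSubfield L)), T ⊆ S → ∀ y : (i : ↥S) → locTorus (maximalRealSubfield L) L i,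
    inner ℂ φ₁ (ω₁ (extendOne (genLevel L) S y) φ₁) = ∏ i : ↥S, localCoeff (genLevel L) ω₁ φ₁ i (y i))
  {S : Finset (Place (maximalRealSubfield L))} (hTS : T ⊆ S) (hT'S : T' ⊆ S)
  (hS : ∀ v : InfinitePlace (maximalRealSubfield L), Sum.inl v ∈ S)
  (X₁ : GenuineCoeffInput L S Sp₁ ω₁ φ₁ χ)
  -- the isometric equivariant EMBEDDING of the torus model into the datum's space
  (E : Sp₁ →ₗᵢ[ℂ] Sp) (hE : ∀ (g : Model L) (v : Sp₁), E (ω₁ g v) = D.ω g (E v))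

include hW hh hj hχΓ hχVΓ P hloc hφ₁ hK₁ hM₁ hTS hT'S hS X₁ hE

set_option synthInstance.maxHeartbeats 200000 in
-- (as above)
/-- **S3 END ALONG AN EMBEDDING, coefficient level.**  File #1's
`exists_compactDomain_thetaLift_ne_zero_genuine_of_embedding` with the torus model's input at coefficient level
(`X₁ : GenuineCoeffInput`): the model `(Sp₁, ω₁, φ₁)` may be any inner product space — e.g. a space of finite
combinations of dilates of the model vector — embedded isometrically and equivariantly into the datum's space `Sp`. -/
theorem exists_compactDomain_thetaLift_ne_zero_genuine_of_coeffEmbedding [IsFiniteMeasure GU.μ] :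
    ∃ 𝓕 : Set (Model L), IsCompact 𝓕 ∧ (interior 𝓕).Nonempty ∧ MeasurableSet 𝓕 ∧
      IsFundamentalDomain (unitaryToModel L).range 𝓕 (haarDatum (genLevel L) (isCompact_genLevel L) (isOpen_genLevel L) S₀).μ ∧
      (haarDatum (genLevel L) (isCompact_genLevel L) (isOpen_genLevel L) S₀).μ 𝓕 ≠ 0 ∧
      (haarDatum (genLevel L) (isCompact_genLevel L) (isOpen_genLevel L) S₀).μ 𝓕 ≠ ⊤ ∧
      ∀ [IsFiniteMeasure (((haarDatum (genLevel L) (isCompact_genLevel L) (isOpen_genLevel L) S₀).μ).restrict 𝓕)]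
        (hk : Measurable (Function.uncurry (thetaFn D GU (E φ₁)))) {Ck : ℝ} (hCk : 0 ≤ Ck)
        (hkC : ∀ q u, ‖thetaFn D GU (E φ₁) q u‖ ≤ Ck),
        PeterssonFubini.theta GU.μ (((haarDatum (genLevel L) (isCompact_genLevel L) (isOpen_genLevel L) S₀).μ).restrict 𝓕) hk
          (measurable_coe_char (genLevel L) (isOpen_genLevel L) χ hχT' hlocχ) hCk hkC (norm_coe_char_le χ) ≠ 0 :=
  exists_compactDomain_thetaLift_ne_zero_genuine_of_coeffInput L S₀ hW hh D GU j hj χ hχΓ hχVΓ P hloc hχT' hlocχ (E φ₁)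
    (Transfer.norm_map_eq_one E hφ₁)
    (Transfer.map_fixed_of_mem ω₁ D.ω E hE hK₁)
    (Transfer.prodFormula_map (genLevel L) ω₁ D.ω E hE φ₁ hM₁) hTS hT'S hS (X₁.map E hE)

end embedding

end ofCoeffInput

end HodgeCM.PerL34.PureTensor

end
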